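import Summits.QuantumFields.YangMills.Theorems.SwapVirialDeficitSigmaBallSlab
import HarnessLib

/-!
# END-CORE N3a: the OFF-CENTRE Σ-slab `∫⁻_{(−s,s)×(a,a+ℓ)×(b,b+ℓ)} (δ²+x²+y²)⁻¹ ≤ 72·s^{1/3}·ℓ^{2/3}` for EVERY `a, b`
# (stub `stub_core_end` / `stub_end_gaussCore`, memo11 §3 (LEAD sfw-p2 g99): the per-ball slab bound under smearing over base squares of side `ℓ = 2ρ₀`;
# free-hands support of ⟨stmt-QuantumFields-24197⟩ `SwapVirialDeficit.SwapGluedStiffness`)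

✓`lintegral_symm_slab_inv_sum_sq_le` is the centred case; the smeared comparison of memo11 §3 integrates the Σ-singularity over squares `(a,a+ℓ)×(b,b+ℓ)` with
arbitrary corners.  The 1D input: for ANY `a` and `ℓ ≥ 0`, `∫⁻_{(a,a+ℓ)} |x|^{-2/3} ≤ 6·ℓ^{1/3}` (`lintegral_Ioo_shift_abs_rpow_le`: positive part by the translation
`x ↦ x + c` (`measurePreserving_add_right`) and monotonicity of `x^{-2/3}`, negative part by reflection); then the AM–GM/puncture/Tonelli argument of
✓`…SigmaBallSlab` verbatim (`ae_eq_sdiff_zero`, ★ `lintegral_offCentre_slab_inv_sum_sq_le`).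

HONEST LABEL: elementary real analysis; `stub_end_gaussCore` (N1 w2, N2 w2+✓glue, N3 w3 in progress, N4 assembler) and stubs core-tip ∕ 001-good, ⟨24197⟩ ∕ ⟨24194⟩ and
every rung OPEN; own crux ⟨22884⟩ OPEN (blocked-on ⟨19935⟩); the Yang–Mills mass gap is NOT proved; no summit is proved by a line.  THEOREMS ONLY (0 `def`, 0 `sorry`),
standard axioms.  Width seat ym-line-sfw-p2-w3 g67 (cell ym-idea-1, free hands), `--supports stmt-QuantumFields-24197`.  References: [folklore].
-/

set_option autoImplicit false

noncomputable section

open MeasureTheory Set Real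
open scoped ENNReal

namespace Summit.QuantumFields.YangMills.Theorems.SwapVirialDeficit.SigmaBall

/-! ## §1 One dimension: any interval of length `ℓ` -/

/-- Positive corner: for `0 ≤ c`, `∫⁻_{(c, c+ℓ)} |x|^{-2/3} ≤ 3·ℓ^{1/3}` (translate to `(0,ℓ)`, where `|y+c|^{-2/3} ≤ |y|^{-2/3}`). [folklore] -/
theorem lintegral_Ioo_pos_shift_abs_rpow_le {c ℓ : ℝ} (hc : 0 ≤ c) (hℓ : 0 ≤ ℓ) :
    ∫⁻ x in Ioo c (c + ℓ), ENNReal.ofReal (|x| ^ (-(2 / 3) : ℝ)) ≤ ENNReal.ofReal (3 * ℓ ^ (1 / 3 : ℝ)) := by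
  have hpre : (fun y : ℝ => y + c) ⁻¹' Ioo c (c + ℓ) = Ioo 0 ℓ := by
    ext y; simp only [mem_preimage, mem_Ioo]; constructor <;> rintro ⟨h1, h2⟩ <;> constructor <;> linarith
  have h := (measurePreserving_add_right (volume : Measure ℝ) c).setLIntegral_comp_preimage (measurableSet_Ioo (a := c) (b := c + ℓ))
    (f := fun x : ℝ => ENNReal.ofReal (|x| ^ (-(2 / 3) : ℝ))) (Measurable.ennreal_ofReal (by fun_prop))
  rw [hpre] at h
  rw [← h, ← lintegral_Ioo_pos_abs_rpow hℓ]
  refine setLIntegral_mono' measurableSet_Ioo fun y hy => ENNReal.ofReal_le_ofReal ?_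
  rw [abs_of_pos (by linarith [hy.1] : 0 < y + c), abs_of_pos hy.1]
  exact Real.rpow_le_rpow_of_nonpos hy.1 (by linarith) (by norm_num)

/-- Negative corner: for `d + ℓ ≤ 0`, `∫⁻_{(d, d+ℓ)} |x|^{-2/3} ≤ 3·ℓ^{1/3}` (reflection of the positive corner). [folklore] -/
theorem lintegral_Ioo_neg_shift_abs_rpow_le {d ℓ : ℝ} (hd : d + ℓ ≤ 0) (hℓ : 0 ≤ ℓ) :
    ∫⁻ x in Ioo d (d + ℓ), ENNReal.ofReal (|x| ^ (-(2 / 3) : ℝ)) ≤ ENNReal.ofReal (3 * ℓ ^ (1 / 3 : ℝ)) := by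
  have hpre : (Neg.neg : ℝ → ℝ) ⁻¹' Ioo (-(d + ℓ)) (-(d + ℓ) + ℓ) = Ioo d (d + ℓ) := by
    ext x; simp only [mem_preimage, mem_Ioo]; constructor <;> rintro ⟨h1, h2⟩ <;> constructor <;> linarith
  have h := (Measure.measurePreserving_neg (volume : Measure ℝ)).setLIntegral_comp_preimage (measurableSet_Ioo (a := -(d + ℓ)) (b := -(d + ℓ) + ℓ))
    (f := fun x : ℝ => ENNReal.ofReal (|x| ^ (-(2 / 3) : ℝ))) (Measurable.ennreal_ofReal (by fun_prop))
  rw [hpre] at h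
  simp only [abs_neg] at h
  rw [h]
  exact lintegral_Ioo_pos_shift_abs_rpow_le (by linarith) hℓ

/-- ★ ANY interval of length `ℓ`: `∫⁻_{(a, a+ℓ)} |x|^{-2/3} ≤ 6·ℓ^{1/3}`. [folklore] -/
theorem lintegral_Ioo_shift_abs_rpow_le (a : ℝ) {ℓ : ℝ} (hℓ : 0 ≤ ℓ) :
    ∫⁻ x in Ioo a (a + ℓ), ENNReal.ofReal (|x| ^ (-(2 / 3) : ℝ)) ≤ ENNReal.ofReal (6 * ℓ ^ (1 / 3 : ℝ)) := by
  -- the positive and negative parts are intervals of length ≤ ℓ with a corner at 0 or beyond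
  have hP : ∫⁻ x in Ioo a (a + ℓ) ∩ Ioi 0, ENNReal.ofReal (|x| ^ (-(2 / 3) : ℝ)) ≤ ENNReal.ofReal (3 * ℓ ^ (1 / 3 : ℝ)) := by
    have hsub : Ioo a (a + ℓ) ∩ Ioi 0 ⊆ Ioo (max a 0) (max a 0 + ℓ) := by
      rintro x ⟨⟨h1, h2⟩, h3⟩
      refine ⟨max_lt h1 h3, ?_⟩
      rcases le_or_gt a 0 with h | h
      · rw [max_eq_right h]; linarith
      · rw [max_eq_left h.le]; linarith
    exact (lintegral_mono_set hsub).trans (lintegral_Ioo_pos_shift_abs_rpow_le (le_max_right a 0) hℓ)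
  have hN : ∫⁻ x in Ioo a (a + ℓ) ∩ Iio 0, ENNReal.ofReal (|x| ^ (-(2 / 3) : ℝ)) ≤ ENNReal.ofReal (3 * ℓ ^ (1 / 3 : ℝ)) := by
    have hsub : Ioo a (a + ℓ) ∩ Iio 0 ⊆ Ioo (min (a + ℓ) 0 - ℓ) (min (a + ℓ) 0 - ℓ + ℓ) := by
      rintro x ⟨⟨h1, h2⟩, h3⟩
      refine ⟨?_, by simp only [sub_add_cancel]; exact lt_min h2 h3⟩
      rcases le_or_gt (a + ℓ) 0 with h | h
      · rw [min_eq_left h]; linarith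
      · rw [min_eq_right h.le]; linarith
    exact (lintegral_mono_set hsub).trans (lintegral_Ioo_neg_shift_abs_rpow_le (by simp only [sub_add_cancel]; exact min_le_right _ _) hℓ)
  have hcover : Ioo a (a + ℓ) ⊆ (Ioo a (a + ℓ) ∩ Ioi 0 ∪ Icc (0:ℝ) 0) ∪ (Ioo a (a + ℓ) ∩ Iio 0) := by
    intro x hx
    rcases lt_trichotomy x 0 with h | h | h
    · exact Or.inr ⟨hx, h⟩
    · exact Or.inl (Or.inr ⟨h.ge, h.le⟩)
    · exact Or.inl (Or.inl ⟨hx, h⟩)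
  have hnull : ∫⁻ x in Icc (0:ℝ) 0, ENNReal.ofReal (|x| ^ (-(2 / 3) : ℝ)) = 0 := by
    rw [Icc_self, Measure.restrict_singleton, lintegral_smul_measure, Real.volume_singleton]; simp
  calc ∫⁻ x in Ioo a (a + ℓ), ENNReal.ofReal (|x| ^ (-(2 / 3) : ℝ))
      ≤ ∫⁻ x in (Ioo a (a + ℓ) ∩ Ioi 0 ∪ Icc (0:ℝ) 0) ∪ (Ioo a (a + ℓ) ∩ Iio 0), ENNReal.ofReal (|x| ^ (-(2 / 3) : ℝ)) := lintegral_mono_set hcover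
    _ ≤ (∫⁻ x in Ioo a (a + ℓ) ∩ Ioi 0 ∪ Icc (0:ℝ) 0, ENNReal.ofReal (|x| ^ (-(2 / 3) : ℝ))) + ∫⁻ x in Ioo a (a + ℓ) ∩ Iio 0, ENNReal.ofReal (|x| ^ (-(2 / 3) : ℝ)) :=
        lintegral_union_le _ _ _
    _ ≤ ((∫⁻ x in Ioo a (a + ℓ) ∩ Ioi 0, ENNReal.ofReal (|x| ^ (-(2 / 3) : ℝ))) + ∫⁻ x in Icc (0:ℝ) 0, ENNReal.ofReal (|x| ^ (-(2 / 3) : ℝ))) +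
          ∫⁻ x in Ioo a (a + ℓ) ∩ Iio 0, ENNReal.ofReal (|x| ^ (-(2 / 3) : ℝ)) := add_le_add (lintegral_union_le _ _ _) le_rfl
    _ ≤ (ENNReal.ofReal (3 * ℓ ^ (1 / 3 : ℝ)) + 0) + ENNReal.ofReal (3 * ℓ ^ (1 / 3 : ℝ)) := add_le_add (add_le_add hP hnull.le) hN
    _ = ENNReal.ofReal (6 * ℓ ^ (1 / 3 : ℝ)) := by
        rw [add_zero, ← ENNReal.ofReal_add (by positivity) (by positivity)]; congr 1; ring

/-- … hence also over the punctured interval `(a, a+ℓ) ∖ {0}`. [folklore] -/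
theorem lintegral_Ioo_sdiff_shift_abs_rpow_le (a : ℝ) {ℓ : ℝ} (hℓ : 0 ≤ ℓ) :
    ∫⁻ x in Ioo a (a + ℓ) \ {0}, ENNReal.ofReal (|x| ^ (-(2 / 3) : ℝ)) ≤ ENNReal.ofReal (6 * ℓ ^ (1 / 3 : ℝ)) :=
  (lintegral_mono_set sdiff_subset).trans (lintegral_Ioo_shift_abs_rpow_le a hℓ)

/-- A set minus `{0}` is a.e. the set (Lebesgue on `ℝ`). [folklore] -/
theorem ae_eq_sdiff_zero (S : Set ℝ) : (S \ {0} : Set ℝ) =ᵐ[volume] S := by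
  refine ae_eq_set.2 ⟨?_, ?_⟩
  · rw [sdiff_eq_empty.2 sdiff_subset]; exact measure_empty
  · exact measure_mono_null (fun x hx => by
      simp only [mem_sdiff, mem_singleton_iff, not_and, not_not] at hx; exact hx.2 hx.1) Real.volume_singleton

/-! ## §2 The off-centre slab -/

/-- ★★ **THE OFF-CENTRE SLAB BOUND**: for every `a b : ℝ`, `0 ≤ s`, `0 ≤ ℓ`,
`∫⁻_{(−s,s)×(a,a+ℓ)×(b,b+ℓ)} (δ²+x²+y²)⁻¹ ≤ 72·s^{1/3}·ℓ^{1/3}·ℓ^{1/3}` on `ℝ × ℝ × ℝ` — the Σ-singularity integrated over a hub slab times ANY base square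
(memo11 §3: smearing over squares of side `ℓ = 2ρ₀`). [folklore] -/
theorem lintegral_offCentre_slab_inv_sum_sq_le {s ℓ : ℝ} (hs : 0 ≤ s) (hℓ : 0 ≤ ℓ) (a b : ℝ) :
    ∫⁻ p in (Ioo (-s) s) ×ˢ ((Ioo a (a + ℓ)) ×ˢ (Ioo b (b + ℓ))), ENNReal.ofReal ((p.1 ^ 2 + p.2.1 ^ 2 + p.2.2 ^ 2)⁻¹)
        ∂(volume : Measure (ℝ × ℝ × ℝ)) ≤
      ENNReal.ofReal (72 * s ^ (1 / 3 : ℝ) * ℓ ^ (1 / 3 : ℝ) * ℓ ^ (1 / 3 : ℝ)) := by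
  -- puncture each interval at 0
  have hae : (((Ioo (-s) s \ {0}) ×ˢ ((Ioo a (a + ℓ) \ {0}) ×ˢ (Ioo b (b + ℓ) \ {0}))) : Set (ℝ × ℝ × ℝ)) =ᵐ[(volume : Measure (ℝ × ℝ × ℝ))]
      ((Ioo (-s) s) ×ˢ ((Ioo a (a + ℓ)) ×ˢ (Ioo b (b + ℓ)))) := by
    rw [Measure.volume_eq_prod, Measure.volume_eq_prod]
    exact Measure.set_prod_ae_eq (ae_eq_sdiff_zero _) (Measure.set_prod_ae_eq (ae_eq_sdiff_zero _) (ae_eq_sdiff_zero _))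
  rw [← setLIntegral_congr hae]
  have hpt : ∀ p ∈ (((Ioo (-s) s \ {0}) ×ˢ ((Ioo a (a + ℓ) \ {0}) ×ˢ (Ioo b (b + ℓ) \ {0}))) : Set (ℝ × ℝ × ℝ)),
      ENNReal.ofReal ((p.1 ^ 2 + p.2.1 ^ 2 + p.2.2 ^ 2)⁻¹) ≤
        ENNReal.ofReal ((1 / 3 : ℝ) * |p.1| ^ (-(2 / 3) : ℝ)) * (ENNReal.ofReal (|p.2.1| ^ (-(2 / 3) : ℝ)) * ENNReal.ofReal (|p.2.2| ^ (-(2 / 3) : ℝ))) := by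
    rintro ⟨x, y, z⟩ ⟨hx, hy, hz⟩
    have hx0 : x ≠ 0 := fun h => hx.2 h
    have hy0 : y ≠ 0 := fun h => hy.2 h
    have hz0 : z ≠ 0 := fun h => hz.2 h
    have h := inv_sum_sq_three_le hx0 hy0 hz0
    rw [← ENNReal.ofReal_mul (Real.rpow_nonneg (abs_nonneg _) _), ← ENNReal.ofReal_mul (mul_nonneg (by norm_num) (Real.rpow_nonneg (abs_nonneg _) _))]
    refine ENNReal.ofReal_le_ofReal ?_
    calc (x ^ 2 + y ^ 2 + z ^ 2)⁻¹ ≤ (1 / 3 : ℝ) * (|x| ^ (-(2 / 3) : ℝ) * |y| ^ (-(2 / 3) : ℝ) * |z| ^ (-(2 / 3) : ℝ)) := h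
      _ = (1 / 3 : ℝ) * |x| ^ (-(2 / 3) : ℝ) * (|y| ^ (-(2 / 3) : ℝ) * |z| ^ (-(2 / 3) : ℝ)) := by ring
  have hI : ∀ (c d : ℝ), MeasurableSet (Ioo c d \ {0} : Set ℝ) := fun c d => measurableSet_Ioo.diff (measurableSet_singleton 0)
  have hmeas : MeasurableSet (((Ioo (-s) s \ {0}) ×ˢ ((Ioo a (a + ℓ) \ {0}) ×ˢ (Ioo b (b + ℓ) \ {0}))) : Set (ℝ × ℝ × ℝ)) :=
    (hI _ _).prod ((hI _ _).prod (hI _ _))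
  have hs1 : ∫⁻ x in Ioo (-s) s \ {0}, ENNReal.ofReal (|x| ^ (-(2 / 3) : ℝ)) ≤ ENNReal.ofReal (6 * s ^ (1 / 3 : ℝ)) := by
    have hsub : (Ioo (-s) s \ {0} : Set ℝ) ⊆ Ioo (-s) 0 ∪ Ioo 0 s := by
      rintro x ⟨⟨h1, h2⟩, h0⟩
      rcases lt_or_gt_of_ne (show x ≠ 0 from h0) with h | h
      · exact Or.inl ⟨h1, h⟩
      · exact Or.inr ⟨h, h2⟩
    exact (lintegral_mono_set hsub).trans (lintegral_puncturedIoo_abs_rpow_le hs)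
  calc ∫⁻ p in ((Ioo (-s) s \ {0}) ×ˢ ((Ioo a (a + ℓ) \ {0}) ×ˢ (Ioo b (b + ℓ) \ {0}))), ENNReal.ofReal ((p.1 ^ 2 + p.2.1 ^ 2 + p.2.2 ^ 2)⁻¹)
        ∂(volume : Measure (ℝ × ℝ × ℝ))
      ≤ ∫⁻ p in ((Ioo (-s) s \ {0}) ×ˢ ((Ioo a (a + ℓ) \ {0}) ×ˢ (Ioo b (b + ℓ) \ {0}))),
          ENNReal.ofReal ((1 / 3 : ℝ) * |p.1| ^ (-(2 / 3) : ℝ)) * (ENNReal.ofReal (|p.2.1| ^ (-(2 / 3) : ℝ)) * ENNReal.ofReal (|p.2.2| ^ (-(2 / 3) : ℝ)))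
          ∂(volume : Measure (ℝ × ℝ × ℝ)) := setLIntegral_mono' hmeas hpt
    _ = (∫⁻ x in Ioo (-s) s \ {0}, ENNReal.ofReal ((1 / 3 : ℝ) * |x| ^ (-(2 / 3) : ℝ))) *
          ((∫⁻ y in Ioo a (a + ℓ) \ {0}, ENNReal.ofReal (|y| ^ (-(2 / 3) : ℝ))) * ∫⁻ z in Ioo b (b + ℓ) \ {0}, ENNReal.ofReal (|z| ^ (-(2 / 3) : ℝ))) := by
        rw [Measure.volume_eq_prod, Measure.volume_eq_prod, ← Measure.prod_restrict, ← Measure.prod_restrict]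
        have h2 : ∫⁻ q : ℝ × ℝ, ENNReal.ofReal (|q.1| ^ (-(2 / 3) : ℝ)) * ENNReal.ofReal (|q.2| ^ (-(2 / 3) : ℝ))
            ∂((volume.restrict (Ioo a (a + ℓ) \ {0})).prod (volume.restrict (Ioo b (b + ℓ) \ {0}))) =
            (∫⁻ y in Ioo a (a + ℓ) \ {0}, ENNReal.ofReal (|y| ^ (-(2 / 3) : ℝ))) * ∫⁻ z in Ioo b (b + ℓ) \ {0}, ENNReal.ofReal (|z| ^ (-(2 / 3) : ℝ)) :=
          lintegral_prod_mul (f := fun y : ℝ => ENNReal.ofReal (|y| ^ (-(2 / 3) : ℝ))) (g := fun z : ℝ => ENNReal.ofReal (|z| ^ (-(2 / 3) : ℝ)))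
            (by fun_prop) (by fun_prop)
        have h1 := lintegral_prod_mul (μ := volume.restrict (Ioo (-s) s \ {0}))
          (ν := (volume.restrict (Ioo a (a + ℓ) \ {0})).prod (volume.restrict (Ioo b (b + ℓ) \ {0})))
          (f := fun x : ℝ => ENNReal.ofReal ((1 / 3 : ℝ) * |x| ^ (-(2 / 3) : ℝ)))
          (g := fun q : ℝ × ℝ => ENNReal.ofReal (|q.1| ^ (-(2 / 3) : ℝ)) * ENNReal.ofReal (|q.2| ^ (-(2 / 3) : ℝ))) (by fun_prop) (by fun_prop)
        rw [h2] at h1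
        exact h1
    _ ≤ ENNReal.ofReal (2 * s ^ (1 / 3 : ℝ)) * (ENNReal.ofReal (6 * ℓ ^ (1 / 3 : ℝ)) * ENNReal.ofReal (6 * ℓ ^ (1 / 3 : ℝ))) := by
        have h1 : ∫⁻ x in Ioo (-s) s \ {0}, ENNReal.ofReal ((1 / 3 : ℝ) * |x| ^ (-(2 / 3) : ℝ)) ≤ ENNReal.ofReal (2 * s ^ (1 / 3 : ℝ)) := by
          have e : ∀ x : ℝ, ENNReal.ofReal ((1 / 3 : ℝ) * |x| ^ (-(2 / 3) : ℝ)) = ENNReal.ofReal (1 / 3 : ℝ) * ENNReal.ofReal (|x| ^ (-(2 / 3) : ℝ)) :=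
            fun x => ENNReal.ofReal_mul (by norm_num)
          simp_rw [e]
          rw [lintegral_const_mul _ (by fun_prop)]
          calc ENNReal.ofReal (1 / 3 : ℝ) * ∫⁻ x in Ioo (-s) s \ {0}, ENNReal.ofReal (|x| ^ (-(2 / 3) : ℝ))
              ≤ ENNReal.ofReal (1 / 3 : ℝ) * ENNReal.ofReal (6 * s ^ (1 / 3 : ℝ)) := mul_le_mul_right hs1 _
            _ = ENNReal.ofReal (2 * s ^ (1 / 3 : ℝ)) := by rw [← ENNReal.ofReal_mul (by norm_num)]; congr 1; ring
        exact mul_le_mul' h1 (mul_le_mul' (lintegral_Ioo_sdiff_shift_abs_rpow_le a hℓ) (lintegral_Ioo_sdiff_shift_abs_rpow_le b hℓ))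
    _ = ENNReal.ofReal (72 * s ^ (1 / 3 : ℝ) * ℓ ^ (1 / 3 : ℝ) * ℓ ^ (1 / 3 : ℝ)) := by
        rw [← ENNReal.ofReal_mul (by positivity), ← ENNReal.ofReal_mul (by positivity)]
        congr 1; ring

end Summit.QuantumFields.YangMills.Theorems.SwapVirialDeficit.SigmaBall

end
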